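import Mathlib
import Summits.Ventures.PercRepro2.MixChordOStarConn

/-!
# Connectivity readings around an ISOLATED `a₃`, and the THREE-PIN STAR (blind cell PercRepro2, night-1 g24;
proofs/NIGHT1-G24.md §7)

The readings of MixChordOStarConn.lean, restated for any configuration `ω` in which `a₃` is isolated
(`hiso : ∀ x, x ≠ a₃ → ¬ Conn ends ω x a₃`): opening one edge `{a₃, u}` makes `a₃` read as `u` and leaves
the other connections (`conn_update_iff_of_iso`, `conn_a3_update_iff_of_iso`); opening two edges `{a₃, u}`,
`{a₃, v}` joins `u` and `v` — the other connections read as in `ω` with an extra `u`–`v` connection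
(`conn_update2_iff_of_iso`), and `a₃` reads as `u` (`conn_a3_update2_iff_of_iso`).  For `a₃` with exactly
the three edges `g = {a₃, o}`, `e = {a₃, a₁}`, `d = {a₃, a₂}` (`hstar3`): `a₃` is isolated when all three are
closed (`not_conn_a3_of_closed3`), and with `e`, `d` open `a₁ ↔ a₂` (`conn_a1_a2_of_ed`).  Own code;
standard axioms.
-/

namespace Summit.Ventures.PercRepro2

open UnionCluster CovForm

namespace Mix

namespace OStar

section Iso

variable {V : Type*} {E : Type*} [DecidableEq E] {ends : E → Sym2 V} {a₃ : V}

/-- Opening one edge `{a₃, u}` at an isolated `a₃` does not change the connections among the other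
vertices. -/
lemma conn_update_iff_of_iso {g : E} {u : V} (hg : ends g = s(a₃, u)) {ω : Config E}
    (hωg : ω g = false) (hiso : ∀ x, x ≠ a₃ → ¬ Conn ends ω x a₃) {x y : V} (hx : x ≠ a₃) (hy : y ≠ a₃) :
    Conn ends (Function.update ω g true) x y ↔ Conn ends ω x y := by
  have key := Block.conn_iff_of_open_edge hg (ω := Function.update ω g true) (by simp) x y
  have hself : Function.update ω g false = ω := Function.update_eq_self_iff.2 hωg.symm
  rw [Function.update_idem, hself] at key
  rw [key]
  constructor
  · rintro (h | ⟨h, _⟩ | ⟨_, h⟩)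
    · exact h
    · exact absurd h (hiso x hx)
    · exact absurd (conn_symm h) (hiso y hy)
  · exact fun h => Or.inl h

/-- With one edge `{a₃, u}` opened at an isolated `a₃`, `a₃` is joined to exactly what `u` is joined to. -/
lemma conn_a3_update_iff_of_iso {g : E} {u : V} (hg : ends g = s(a₃, u)) {ω : Config E}
    (hωg : ω g = false) (hiso : ∀ x, x ≠ a₃ → ¬ Conn ends ω x a₃) {x : V} (hx : x ≠ a₃) :
    Conn ends (Function.update ω g true) x a₃ ↔ Conn ends ω x u := by
  have key := Block.conn_iff_of_open_edge hg (ω := Function.update ω g true) (by simp) x a₃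
  have hself : Function.update ω g false = ω := Function.update_eq_self_iff.2 hωg.symm
  rw [Function.update_idem, hself] at key
  rw [key]
  constructor
  · rintro (h | ⟨h, _⟩ | ⟨h, _⟩)
    · exact absurd h (hiso x hx)
    · exact absurd h (hiso x hx)
    · exact h
  · exact fun h => Or.inr (Or.inr ⟨h, conn_refl ends ω a₃⟩)

/-- Opening two edges `{a₃, u}`, `{a₃, v}` at an isolated `a₃`: the other vertices are connected as in `ω`
with an extra `u`–`v` connection. -/
lemma conn_update2_iff_of_iso {g d : E} {u v : V} (hg : ends g = s(a₃, u)) (hd : ends d = s(a₃, v))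
    (hgd : g ≠ d) {ω : Config E} (hωg : ω g = false) (hωd : ω d = false)
    (hiso : ∀ x, x ≠ a₃ → ¬ Conn ends ω x a₃) (hv : v ≠ a₃) {x y : V} (hx : x ≠ a₃)
    (hy : y ≠ a₃) :
    Conn ends (Function.update (Function.update ω g true) d true) x y ↔
      Conn ends ω x y ∨ (Conn ends ω x u ∧ Conn ends ω v y) ∨ (Conn ends ω x v ∧ Conn ends ω u y) := by
  have key := Block.conn_iff_of_open_edge hd (ω := Function.update (Function.update ω g true) d true)
    (by simp) x y
  have hcl : Function.update (Function.update (Function.update ω g true) d true) d false =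
      Function.update ω g true := by
    rw [Function.update_idem, Function.update_eq_self_iff, Function.update_of_ne hgd.symm, hωd]
  rw [hcl, conn_update_iff_of_iso hg hωg hiso hx hy, conn_a3_update_iff_of_iso hg hωg hiso hx,
    conn_update_iff_of_iso hg hωg hiso hv hy, conn_update_iff_of_iso hg hωg hiso hx hv] at key
  rw [key]
  have h3y : Conn ends (Function.update ω g true) a₃ y ↔ Conn ends ω u y := by
    rw [← (⟨conn_symm, conn_symm⟩ : Conn ends _ y a₃ ↔ Conn ends _ a₃ y), conn_a3_update_iff_of_iso hg hωg hiso hy]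
    exact ⟨conn_symm, conn_symm⟩
  rw [h3y]

/-- With two edges `{a₃, u}`, `{a₃, v}` opened at an isolated `a₃`, `a₃` is joined to what `u` or `v` is
joined to. -/
lemma conn_a3_update2_iff_of_iso {g d : E} {u v : V} (hg : ends g = s(a₃, u)) (hd : ends d = s(a₃, v))
    (hgd : g ≠ d) {ω : Config E} (hωg : ω g = false) (hωd : ω d = false)
    (hiso : ∀ x, x ≠ a₃ → ¬ Conn ends ω x a₃) (hv : v ≠ a₃) {x : V} (hx : x ≠ a₃) :
    Conn ends (Function.update (Function.update ω g true) d true) x a₃ ↔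
      Conn ends ω x u ∨ Conn ends ω x v := by
  have key := Block.conn_iff_of_open_edge hd (ω := Function.update (Function.update ω g true) d true)
    (by simp) x a₃
  have hcl : Function.update (Function.update (Function.update ω g true) d true) d false =
      Function.update ω g true := by
    rw [Function.update_idem, Function.update_eq_self_iff, Function.update_of_ne hgd.symm, hωd]
  rw [hcl, conn_a3_update_iff_of_iso hg hωg hiso hx, conn_update_iff_of_iso hg hωg hiso hx hv] at key
  rw [key]
  have h33 : Conn ends (Function.update ω g true) a₃ a₃ := conn_refl _ _ _
  constructor
  · rintro (h | ⟨h, _⟩ | ⟨h, _⟩)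
    · exact Or.inl h
    · exact Or.inl h
    · exact Or.inr h
  · rintro (h | h)
    · exact Or.inl h
    · exact Or.inr (Or.inr ⟨h, h33⟩)

end Iso

section Star3

variable {V : Type*} {E : Type*} [DecidableEq E] {ends : E → Sym2 V} {g e d : E} {o a₁ a₂ a₃ : V}

omit [DecidableEq E] in
/-- With the three edges of `a₃` closed, `a₃` is isolated. -/
lemma not_conn_a3_of_closed3 (hstar3 : ∀ e', a₃ ∈ ends e' → e' = g ∨ e' = e ∨ e' = d) {ω : Config E}
    (hωg : ω g = false) (hωe : ω e = false) (hωd : ω d = false) {x : V} (hx : x ≠ a₃) :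
    ¬ Conn ends ω x a₃ := by
  intro h
  have hmem : a₃ ∈ ({y : V | y ≠ a₃} : Set V) :=
    mem_of_conn_of_closed (S := {y : V | y ≠ a₃}) (fun y hy z hadj => by
      rw [openGraph_adj] at hadj
      obtain ⟨_, e', he', hends⟩ := hadj
      intro hz
      rw [hz] at hends
      have h3 : a₃ ∈ ends e' := by rw [hends]; exact Sym2.mem_mk_right y a₃
      rcases hstar3 e' h3 with h' | h' | h'
      · rw [h', hωg] at he'; exact Bool.false_ne_true he'
      · rw [h', hωe] at he'; exact Bool.false_ne_true he'
      · rw [h', hωd] at he'; exact Bool.false_ne_true he') hx h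
  exact hmem rfl

omit [DecidableEq E] in
/-- With `e = {a₃, a₁}` and `d = {a₃, a₂}` open, `a₁ ↔ a₂`. -/
lemma conn_a1_a2_of_ed (he : ends e = s(a₃, a₁)) (hd : ends d = s(a₃, a₂)) {ω : Config E}
    (hωe : ω e = true) (hωd : ω d = true) : Conn ends ω a₁ a₂ :=
  conn_trans (conn_symm (conn_of_openAdj ⟨e, hωe, he⟩)) (conn_of_openAdj ⟨d, hωd, hd⟩)

end Star3

end OStar

end Mix

end Summit.Ventures.PercRepro2
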